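import Mathlib
import HarnessLib
import Literature.NumberTheory.LFunctions.ZetaScrew
import Literature.NumberTheory.LFunctions.ZetaScrewThm41Proofs

/-!
# Route `IntegerScrew` — the SHARP leading term of the pivot law:
# `2Ψ(t) = t log(1/t) − c₀ t + O(t²)` and `M·2Ψ(log(M/(M−1))) = log M − c₀ + O(log M/M)`, `c₀ = log 2π + γ₀ − 1`

HOME/pivot/PIVOT-LAW.md §2a(ii) states the DERIVED leading behaviour of the trial energy that
bounds every pivot (`d_M ≤ 2Ψ(h_M)`, `h_M = log(M/(M−1))`, `IntegerScrewPivotUpperBound`):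
`L(M) := M·2Ψ(h_M) = log M − c₀ + o(1)` with `c₀ = log 2π + γ₀ − 1 = 1.41509…`. The companions
`IntegerScrewPivotLogBound` / `IntegerScrewIncrementLogLower` give `log M + O(1)` with crude
constants; this file proves the sharp constant, from the closed form of `Ψ'` on the prime-free wall
(`Literature.NumberTheory.LFunctions.hasDerivAt_zetaScrew_wall`:
`Ψ'(u) = 4 sinh(u/2) − (γ₀ + π/2 + 3 log 2 + log π)/2 + ½(log(1+e^{−u/2}) − log(1−e^{−u/2})) + arctan(e^{−u/2})`):

* `abs_wallDeriv_sub_le` (private): for `0 < u ≤ ½`, `|Ψ'(u) − Λ'(u)| ≤ 4u` where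
  `Λ(u) = (−u log u − c₀u)/2`, `Λ'(u) = −(log u)/2 − (γ₀ + log 2π)/2` (elementary: `|e^{±x} − 1 ∓ x| ≤ x²`,
  `1 − 1/r ≤ log r ≤ r − 1`, `arctan` is 1-Lipschitz, `arctan 1 = π/4`, `log 2π = log 2 + log π`);
* **`abs_zetaScrew_sub_leadingModel_le`** : `|Ψ(t) − Λ(t)| ≤ 4t²` for `0 < t ≤ ½`, i.e.
  `|2Ψ(t) − (t log(1/t) − c₀t)| ≤ 8t²` (mean value inequality on `[0, t]` with `Ψ(0) = Λ(0) = 0`);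
* **`abs_incrementEnergy_sub_le`** : `|M·2Ψ(log(M/(M−1))) − (log M − c₀)| ≤ (log M + 19)/(M − 1)`
  for every `M ≥ 3`;
* **`tendsto_incrementEnergy_sub_log`** : `M·2Ψ(log(M/(M−1))) − log M → −c₀` as `M → ∞`.

So the increment energy of Kreĭn's screw line between consecutive log-integer nodes, scaled by
`M`, is `log M − (log 2π + γ₀ − 1) + O(log M/M)` — the one-level (zero-density) term of the pivot
law, now kernel-checked; every statement about the deficit `G(M) = L(M) − M·d_M` beyond `G ≥ 0`
remains an RH-consequence measurement (PIVOT-LAW §4/§9). No statement here involves the zeros of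
`ζ`. Reference for `Ψ` and the wall formula: M. Suzuki, J. Lond. Math. Soc. (2) 108 (2023) =
arXiv:2206.03682, (1.1) and the proof of Thm 4.1 [Suzuki2023].
-/

noncomputable section

-- D-0017: `Summit.<S>.<S>.…` is the designed namespace of a single-problem summit.
set_option linter.dupNamespace false

namespace Summit.RiemannHypothesis.RiemannHypothesis.Theorems.IntegerScrew

open Literature.NumberTheory.LFunctions Literature.NumberTheory.LFunctions.Suzuki2023Thm41

/-- The two-term model `Λ(u) = (−u log u − c₀u)/2` (`2Λ(u) = u log(1/u) − c₀u`, `c₀ = log 2π + γ₀ − 1`)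
has `Λ'(u) = −(log u)/2 − (γ₀ + log 2π)/2` for `u > 0`. [folklore] -/
private theorem hasDerivAt_leadingModel {u : ℝ} (hu : 0 < u) :
    HasDerivAt (fun u : ℝ => (-(u * Real.log u) - (Real.log (2 * Real.pi) + Real.eulerMascheroniConstant - 1) * u) / 2)
      (-(Real.log u) / 2 - (Real.eulerMascheroniConstant + Real.log (2 * Real.pi)) / 2) u := by
  have h1 : HasDerivAt (fun u : ℝ => u * Real.log u) (Real.log u + 1) u := by
    simpa using Real.hasDerivAt_mul_log hu.ne'
  have h2 : HasDerivAt (fun u : ℝ => (Real.log (2 * Real.pi) + Real.eulerMascheroniConstant - 1) * u) ((Real.log (2 * Real.pi) + Real.eulerMascheroniConstant - 1) * 1) u :=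
    (hasDerivAt_id' u).const_mul _
  have h := ((h1.fun_neg).fun_sub h2).div_const 2
  refine h.congr_deriv ?_
  ring

/-- `|log r| ≤ (1 − r)/r`-type bound: for `0 < 1 − a ≤ r ≤ 1`, `|log r| ≤ a/(1 − a)`. [folklore] -/
private theorem abs_log_le_of_one_sub_le {r a : ℝ} (ha : a < 1) (hr : 1 - a ≤ r) (hr1 : r ≤ 1) :
    |Real.log r| ≤ a / (1 - a) := by
  have hr0 : 0 < r := lt_of_lt_of_le (by linarith) hr
  have hlog0 : Real.log r ≤ 0 := Real.log_nonpos hr0.le hr1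
  rw [abs_of_nonpos hlog0]
  have h1 := Real.one_sub_inv_le_log_of_pos hr0
  -- −log r ≤ 1/r − 1 ≤ 1/(1−a) − 1 = a/(1−a)
  have h2 : r⁻¹ ≤ (1 - a)⁻¹ := inv_anti₀ (by linarith) hr
  have hne : (1 - a) ≠ 0 := by linarith
  have h3 : (1 - a)⁻¹ - 1 = a / (1 - a) := by
    rw [inv_eq_one_div, div_sub_one hne]
    congr 1; ring
  rw [← h3]
  linarith

/-- The derivative gap on the wall near `0`: for `0 < u ≤ ½`,
`|Ψ₁-closed-form(u) − Λ'(u)| ≤ 4u`. [folklore] -/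
private theorem abs_wallDeriv_sub_le {u : ℝ} (hu0 : 0 < u) (hu : u ≤ 1 / 2) :
    |(4 * Real.sinh (u / 2)
        - (Real.eulerMascheroniConstant + Real.pi / 2 + 3 * Real.log 2 + Real.log Real.pi) / 2
        + ((Real.log (1 + Real.exp (-(u / 2))) - Real.log (1 - Real.exp (-(u / 2)))) / 2
          + Real.arctan (Real.exp (-(u / 2)))))
      - (-(Real.log u) / 2 - (Real.eulerMascheroniConstant + Real.log (2 * Real.pi)) / 2)| ≤ 4 * u := by
  set x : ℝ := u / 2 with hx
  have hx0 : 0 < x := by positivity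
  have hx1 : x ≤ 1 / 4 := by rw [hx]; linarith
  set y : ℝ := Real.exp (-x) with hy
  have hy0 : 0 < y := Real.exp_pos _
  -- e^{-x} bounds: 1 − x ≤ y ≤ 1 − x + x²
  have hylo : 1 - x ≤ y := by have := Real.add_one_le_exp (-x); rw [hy]; linarith
  have hyhi : y ≤ 1 - x + x ^ 2 := by
    have := Real.abs_exp_sub_one_sub_id_le (x := -x) (by rw [abs_neg, abs_of_pos hx0]; linarith)
    rw [abs_le] at this
    have h2 := this.2
    rw [hy]; nlinarith
  have hy1 : y < 1 := by
    have hxx : x ^ 2 < x := by nlinarith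
    linarith
  -- (p1) sinh: |4 sinh x − 4x| ≤ 4x², and 4x = 2u
  have hsinh : |4 * Real.sinh x - 4 * x| ≤ 4 * x ^ 2 := by
    rw [Real.sinh_eq]
    have e1 := Real.abs_exp_sub_one_sub_id_le (x := x) (by rw [abs_of_pos hx0]; linarith)
    have e2 := Real.abs_exp_sub_one_sub_id_le (x := -x) (by rw [abs_neg, abs_of_pos hx0]; linarith)
    rw [abs_le] at e1 e2 ⊢
    constructor <;> nlinarith [e1.1, e1.2, e2.1, e2.2]
  -- (p2a) |log(1+y) − log 2| ≤ x  ((1+y)/2 ∈ [1 − x/2, 1])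
  have hp2a : |Real.log (1 + y) - Real.log 2| ≤ x := by
    rw [← Real.log_div (by linarith) (by norm_num)]
    have h := abs_log_le_of_one_sub_le (a := x / 2) (r := (1 + y) / 2) (by linarith)
      (by linarith) (by linarith)
    refine le_trans h ?_
    rw [div_le_iff₀ (by linarith)]; nlinarith
  -- (p2b) |log(1−y) − log x| ≤ 2x  ((1−y)/x ∈ [1 − x, 1])
  have hp2b : |Real.log (1 - y) - Real.log x| ≤ 2 * x := by
    rw [← Real.log_div (by linarith) hx0.ne']
    have hr1 : (1 - y) / x ≤ 1 := by rw [div_le_one hx0]; linarith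
    have hr2 : 1 - x ≤ (1 - y) / x := by rw [le_div_iff₀ hx0]; nlinarith
    have h := abs_log_le_of_one_sub_le (a := x) (r := (1 - y) / x) (by linarith) hr2 hr1
    refine le_trans h ?_
    rw [div_le_iff₀ (by linarith)]; nlinarith
  -- (p3) |arctan y − π/4| ≤ |y − 1| ≤ x
  have hp3 : |Real.arctan y - Real.pi / 4| ≤ x := by
    rw [← Real.arctan_one]
    have h := Convex.norm_image_sub_le_of_norm_deriv_le (f := Real.arctan) (s := Set.univ) (C := 1)
      (fun z _ => Real.differentiable_arctan z) (fun z _ => by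
        rw [Real.deriv_arctan]; simp only [norm_div, norm_one, Real.norm_eq_abs]
        rw [abs_of_pos (by positivity), div_le_one (by positivity)]; nlinarith [sq_nonneg z])
      convex_univ (Set.mem_univ 1) (Set.mem_univ y)
    simp only [Real.norm_eq_abs, one_mul] at h
    refine le_trans h ?_
    rw [abs_le]; constructor <;> nlinarith [sq_nonneg x]
  -- the algebra: log u = log x + log 2, log(2π) = log 2 + log π
  have hlogu : Real.log u = Real.log x + Real.log 2 := by
    rw [hx, ← Real.log_mul hx0.ne' (by norm_num)]; congr 1; ring
  have hlog2pi : Real.log (2 * Real.pi) = Real.log 2 + Real.log Real.pi :=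
    Real.log_mul (by norm_num) Real.pi_pos.ne'
  rw [hlogu, hlog2pi]
  -- assemble
  have hu2 : 4 * x ^ 2 ≤ u / 2 := by rw [hx]; nlinarith
  rw [abs_le] at hsinh hp2a hp2b hp3 ⊢
  constructor <;> nlinarith [hsinh.1, hsinh.2, hp2a.1, hp2a.2, hp2b.1, hp2b.2, hp3.1, hp3.2]

/-- **Sharp leading term of `Ψ` at `0`: `|Ψ(t) − Λ(t)| ≤ 4t²` for `0 < t ≤ ½`**, i.e.
`|2Ψ(t) − (t log(1/t) − c₀ t)| ≤ 8t²` with `c₀ = log 2π + γ₀ − 1`. [folklore] -/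
theorem abs_zetaScrew_sub_leadingModel_le {t : ℝ} (ht0 : 0 < t) (ht : t ≤ 1 / 2) :
    |zetaScrew t - (-(t * Real.log t) - (Real.log (2 * Real.pi) + Real.eulerMascheroniConstant - 1) * t) / 2| ≤ 4 * t ^ 2 := by
  have htlog : t < Real.log 2 := by have := Real.log_two_gt_d9; linarith
  set D : ℝ → ℝ := fun u => zetaScrew u - (-(u * Real.log u) - (Real.log (2 * Real.pi) + Real.eulerMascheroniConstant - 1) * u) / 2 with hD
  have hD0 : D 0 = 0 := by simp [hD, zetaScrew_zero]
  have hcont : ContinuousOn D (Set.Icc 0 t) := by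
    apply Continuous.continuousOn
    refine continuous_zetaScrew.sub ?_
    exact ((Real.continuous_mul_log.neg).sub (continuous_const.mul continuous_id)).div_const 2
  have hderiv : ∀ u ∈ Set.Ioo 0 t, HasDerivAt D
      ((4 * Real.sinh (u / 2)
        - (Real.eulerMascheroniConstant + Real.pi / 2 + 3 * Real.log 2 + Real.log Real.pi) / 2
        + ((Real.log (1 + Real.exp (-(u / 2))) - Real.log (1 - Real.exp (-(u / 2)))) / 2
          + Real.arctan (Real.exp (-(u / 2)))))
      - (-(Real.log u) / 2 - (Real.eulerMascheroniConstant + Real.log (2 * Real.pi)) / 2)) u := by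
    intro u hu
    exact (hasDerivAt_zetaScrew_wall hu.1 (lt_trans hu.2 htlog)).sub (hasDerivAt_leadingModel hu.1)
  have hdiff : DifferentiableOn ℝ D (interior (Set.Icc 0 t)) := by
    rw [interior_Icc]; exact fun u hu => (hderiv u hu).differentiableAt.differentiableWithinAt
  have hbound : ∀ u ∈ interior (Set.Icc 0 t), |deriv D u| ≤ 4 * t := by
    rw [interior_Icc]; intro u hu
    rw [(hderiv u hu).deriv]
    exact le_trans (abs_wallDeriv_sub_le hu.1 (by linarith [hu.2])) (by linarith [hu.2])
  have hup := (convex_Icc 0 t).image_sub_le_mul_sub_of_deriv_le hcont hdiff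
    (fun u hu => (abs_le.mp (hbound u hu)).2) 0 (Set.left_mem_Icc.mpr ht0.le) t
    (Set.right_mem_Icc.mpr ht0.le) ht0.le
  have hlo := (convex_Icc 0 t).mul_sub_le_image_sub_of_le_deriv hcont hdiff
    (fun u hu => (abs_le.mp (hbound u hu)).1) 0 (Set.left_mem_Icc.mpr ht0.le) t
    (Set.right_mem_Icc.mpr ht0.le) ht0.le
  rw [hD0, sub_zero] at hup hlo
  simp only [hD] at hup hlo
  rw [abs_le]; constructor <;> nlinarith

set_option maxHeartbeats 400000 in
/-- **The increment energy, sharp: `|M·2Ψ(log(M/(M−1))) − (log M − c₀)| ≤ (log M + 19)/(M − 1)`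
for `M ≥ 3`** (`c₀ = log 2π + γ₀ − 1`): the DERIVED two-term leading behaviour
`L(M) = log M − c₀ + O(log M/M)` of the pivot law. [folklore] -/
theorem abs_incrementEnergy_sub_le (M : ℕ) (hM : 3 ≤ M) :
    |(M : ℝ) * (2 * zetaScrew (Real.log ((M : ℝ) / ((M : ℝ) - 1)))) - (Real.log M - (Real.log (2 * Real.pi) + Real.eulerMascheroniConstant - 1))|
      ≤ (Real.log M + 19) / ((M : ℝ) - 1) := by
  have hM' : (3 : ℝ) ≤ (M : ℝ) := by exact_mod_cast hM
  have hM1 : (0 : ℝ) < (M : ℝ) - 1 := by linarith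
  have hM0 : (0 : ℝ) < (M : ℝ) := by linarith
  set x : ℝ := (M : ℝ) / ((M : ℝ) - 1) with hx
  have hx_pos : 0 < x := by positivity
  have hx1 : x - 1 = 1 / ((M : ℝ) - 1) := by rw [hx]; field_simp; ring
  have hxinv : 1 - x⁻¹ = 1 / (M : ℝ) := by rw [hx]; field_simp; ring
  set h : ℝ := Real.log x with hhdef
  have hh_le : h ≤ 1 / ((M : ℝ) - 1) := by rw [hhdef, ← hx1]; exact Real.log_le_sub_one_of_pos hx_pos
  have hh_ge : 1 / (M : ℝ) ≤ h := by rw [hhdef, ← hxinv]; exact Real.one_sub_inv_le_log_of_pos hx_pos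
  have hh_pos : 0 < h := lt_of_lt_of_le (by positivity) hh_ge
  have hh_half : h ≤ 1 / 2 := le_trans hh_le (by
    rw [div_le_div_iff_of_pos_left one_pos hM1 (by norm_num)]; linarith)
  have hE := abs_zetaScrew_sub_leadingModel_le hh_pos hh_half
  -- the model at h: (−h log h − c₀ h)/2, and −log h ∈ [log(M−1), log M]
  have hlogh_hi : -Real.log h ≤ Real.log M := by
    rw [← Real.log_inv]
    apply Real.log_le_log (by positivity)
    rw [inv_le_comm₀ hh_pos hM0]; rw [one_div] at hh_ge; exact hh_ge
  have hlogh_lo : Real.log ((M : ℝ) - 1) ≤ -Real.log h := by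
    rw [← Real.log_inv]
    apply Real.log_le_log hM1
    rw [le_inv_comm₀ hM1 hh_pos]; rw [one_div] at hh_le; exact hh_le
  have hlogM1 : Real.log ((M : ℝ) - 1) = Real.log M + Real.log (1 - 1 / (M : ℝ)) := by
    rw [← Real.log_mul hM0.ne' (by
      have : 0 < 1 - 1 / (M : ℝ) := by rw [sub_pos, div_lt_one hM0]; linarith
      exact this.ne')]
    congr 1; field_simp
  have hlog1 : -(1 / ((M : ℝ) - 1)) ≤ Real.log (1 - 1 / (M : ℝ)) := by
    have hpos : 0 < 1 - 1 / (M : ℝ) := by rw [sub_pos, div_lt_one hM0]; linarith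
    have := Real.one_sub_inv_le_log_of_pos hpos
    have e : 1 - (1 - 1 / (M : ℝ))⁻¹ = -(1 / ((M : ℝ) - 1)) := by field_simp; ring
    linarith
  have hMh_lo : 1 ≤ (M : ℝ) * h := by
    have := mul_le_mul_of_nonneg_left hh_ge hM0.le
    rwa [one_div, mul_inv_cancel₀ hM0.ne'] at this
  have hMh_hi : (M : ℝ) * h ≤ 1 + 1 / ((M : ℝ) - 1) := by
    have := mul_le_mul_of_nonneg_left hh_le hM0.le
    have e : (M : ℝ) * (1 / ((M : ℝ) - 1)) = 1 + 1 / ((M : ℝ) - 1) := by field_simp; ring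
    linarith
  have hc0 : 0 < (Real.log (2 * Real.pi) + Real.eulerMascheroniConstant - 1) ∧
      (Real.log (2 * Real.pi) + Real.eulerMascheroniConstant - 1) < 2 := by
    have h1 := Real.eulerMascheroniConstant_lt_two_thirds
    have h2 := Real.one_half_lt_eulerMascheroniConstant
    have h3 : 1 < Real.log (2 * Real.pi) ∧ Real.log (2 * Real.pi) < 2 := by
      constructor
      · rw [Real.lt_log_iff_exp_lt (by positivity)]
        have := Real.exp_one_lt_d9; have := Real.pi_gt_three; linarith
      · rw [Real.log_lt_iff_lt_exp (by positivity)]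
        have := Real.pi_lt_d2
        have h4 : (6.3 : ℝ) < Real.exp 2 := by
          have := Real.sum_le_exp_of_nonneg (show (0:ℝ) ≤ 2 by norm_num) 6
          norm_num [Finset.sum_range_succ, Nat.factorial] at this ⊢; linarith
        linarith
    constructor <;> linarith [h3.1, h3.2]
  have hlogM0 : 0 ≤ Real.log (M : ℝ) := Real.log_nonneg (by linarith)
  -- main estimate
  rw [abs_le] at hE ⊢
  have hMpos : (0 : ℝ) ≤ M := hM0.le
  have hh2 : (M : ℝ) * (4 * h ^ 2) ≤ 8 / ((M : ℝ) - 1) := by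
    have h1 : h ^ 2 ≤ (1 / ((M : ℝ) - 1)) ^ 2 := pow_le_pow_left₀ hh_pos.le hh_le 2
    have h2 : (M : ℝ) / ((M : ℝ) - 1) ≤ 2 := by rw [div_le_iff₀ hM1]; linarith
    calc (M : ℝ) * (4 * h ^ 2) ≤ (M : ℝ) * (4 * (1 / ((M : ℝ) - 1)) ^ 2) := by gcongr
      _ = 4 * ((M : ℝ) / ((M : ℝ) - 1)) * (1 / ((M : ℝ) - 1)) := by ring
      _ ≤ 4 * 2 * (1 / ((M : ℝ) - 1)) := by gcongr
      _ = 8 / ((M : ℝ) - 1) := by ring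
  have hinv : (0 : ℝ) < 1 / ((M : ℝ) - 1) := by positivity
  set c0 : ℝ := (Real.log (2 * Real.pi) + Real.eulerMascheroniConstant - 1) with hc0def
  have hc0inv : c0 * (1 / ((M : ℝ) - 1)) ≤ 2 * (1 / ((M : ℝ) - 1)) :=
    mul_le_mul_of_nonneg_right hc0.2.le hinv.le
  have e19 : (Real.log M + 19) / ((M : ℝ) - 1)
      = Real.log M * (1 / ((M : ℝ) - 1)) + 19 * (1 / ((M : ℝ) - 1)) := by ring
  have e8 : (8 : ℝ) / ((M : ℝ) - 1) = 8 * (1 / ((M : ℝ) - 1)) := by ring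
  rw [e8] at hh2
  rw [e19]
  have hlogMinv : 0 ≤ Real.log M * (1 / ((M : ℝ) - 1)) := by positivity
  constructor
  · -- lower bound
    have e1 : (-(h * Real.log h) - c0 * h) / 2 - 4 * h ^ 2 ≤ zetaScrew h := by
      linarith [hE.1]
    have key := mul_le_mul_of_nonneg_left e1 hM0.le
    have t1 : Real.log ((M : ℝ) - 1) ≤ (M : ℝ) * h * (-Real.log h) := by
      have := mul_le_mul hMh_lo hlogh_lo (Real.log_nonneg (by linarith)) (by positivity)
      linarith
    have t2 : (M : ℝ) * h * c0 ≤ (1 + 1 / ((M : ℝ) - 1)) * c0 :=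
      mul_le_mul_of_nonneg_right hMh_hi hc0.1.le
    nlinarith [key, t1, t2, hh2, hlog1, hlogM1, hc0inv, hlogMinv, hc0.1]
  · -- upper bound
    have e2 : zetaScrew h ≤ (-(h * Real.log h) - c0 * h) / 2 + 4 * h ^ 2 := by
      linarith [hE.2]
    have key := mul_le_mul_of_nonneg_left e2 hM0.le
    have hlogM1nn : 0 ≤ Real.log ((M : ℝ) - 1) := Real.log_nonneg (by linarith)
    have t1 : (M : ℝ) * h * (-Real.log h) ≤ (1 + 1 / ((M : ℝ) - 1)) * Real.log M :=
      mul_le_mul hMh_hi hlogh_hi (by linarith) (by positivity)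
    have t2 : 1 * c0 ≤ (M : ℝ) * h * c0 :=
      mul_le_mul_of_nonneg_right hMh_lo hc0.1.le
    nlinarith [key, t1, t2, hh2, hinv]

/-- **`M·2Ψ(log(M/(M−1))) − log M → −c₀ = −(log 2π + γ₀ − 1)`** as `M → ∞`: the DERIVED constant of
the pivot law's leading term `L(M) = log M − c₀ + o(1)`. [folklore] -/
theorem tendsto_incrementEnergy_sub_log :
    Filter.Tendsto (fun M : ℕ => (M : ℝ) * (2 * zetaScrew (Real.log ((M : ℝ) / ((M : ℝ) - 1))))
        - Real.log M) Filter.atTop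
      (nhds (-(Real.log (2 * Real.pi) + Real.eulerMascheroniConstant - 1))) := by
  set c0 : ℝ := Real.log (2 * Real.pi) + Real.eulerMascheroniConstant - 1 with hc0
  have hcast : Filter.Tendsto (fun M : ℕ => (M : ℝ) - 1) Filter.atTop Filter.atTop := by
    have := Filter.tendsto_atTop_add_const_right Filter.atTop (-1 : ℝ) tendsto_natCast_atTop_atTop
    simpa [sub_eq_add_neg] using this
  have h1 : Filter.Tendsto (fun M : ℕ => Real.log M / ((M : ℝ) - 1)) Filter.atTop (nhds 0) := by
    have h := (Real.tendsto_pow_log_div_mul_add_atTop 1 (-1) 1 one_ne_zero).comp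
      tendsto_natCast_atTop_atTop
    refine h.congr fun M => ?_
    simp only [Function.comp_apply, pow_one, one_mul]
    ring_nf
  have h2 : Filter.Tendsto (fun M : ℕ => (19 : ℝ) / ((M : ℝ) - 1)) Filter.atTop (nhds 0) :=
    tendsto_const_nhds.div_atTop hcast
  have hb : Filter.Tendsto (fun M : ℕ => (Real.log M + 19) / ((M : ℝ) - 1)) Filter.atTop (nhds 0) := by
    have := h1.add h2
    simp only [add_zero] at this
    refine this.congr fun M => ?_
    ring
  have hbound : ∀ᶠ M : ℕ in Filter.atTop,
      ‖((M : ℝ) * (2 * zetaScrew (Real.log ((M : ℝ) / ((M : ℝ) - 1)))) - Real.log M) - (-c0)‖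
        ≤ (Real.log M + 19) / ((M : ℝ) - 1) := by
    filter_upwards [Filter.eventually_ge_atTop 3] with M hM
    rw [Real.norm_eq_abs]
    have h := abs_incrementEnergy_sub_le M hM
    have e : (M : ℝ) * (2 * zetaScrew (Real.log ((M : ℝ) / ((M : ℝ) - 1)))) - Real.log M - -c0
        = (M : ℝ) * (2 * zetaScrew (Real.log ((M : ℝ) / ((M : ℝ) - 1)))) - (Real.log M - c0) := by
      ring
    rw [e]; exact h
  have h := squeeze_zero_norm' hbound hb
  exact tendsto_sub_nhds_zero_iff.mp h

end Summit.RiemannHypothesis.RiemannHypothesis.Theorems.IntegerScrew
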